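import Summits.QuantumFields.YangMills.Theorems.BalabanUVNodesN06Row17LocalClauseAtPureGauge
import Literature.MathematicalPhysics.QuantumFieldTheory.Balaban1983to89.B9Eq335CubeDomCoverWideP
import Literature.MathematicalPhysics.QuantumFieldTheory.Balaban1983to89.B9DeltaALocalReadingsInCollarY

/-!
# BalabanUVNodes ∕ N06 ([B9], `Dag.B9_main`) — ROW 17's LOCAL CLAUSE ON PRINT'S CLASS (3.35) FROM THE CHART-BALL POSITIVITY: `hloc(U)` for EVERY `U` of
# `(bg9YP … x).Reg335 c α₀` follows from ONE displayed analytic input — positivity of the padded local operator `Δ_{a,□}(e^{iηA′})` on a sup-ball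
# `‖A′‖ < r` around `U₀ = 1` (the N10 lane's station L5) with `2L⁴·M·α₀·(L^{j(□)}η)⁻¹ ≤ r` — print's p. 416 road with the gauge step, the locality step and
# the class-cube step all PROVED

Track A of `YM-PLAN.md` (cell `pub-ymgap`, HUMAN RULING D-0062), node **N06** = [Balaban1985BackgroundPropagators] Thms 3.1–3.15; seat `pub-ymgap-dag-n06-j`
(bundle F5, rows 15–17), g23.  A HELPER (count-neutral, `--supports` only).

THE PRINT.  [B9] p. 416 (proof of Thm 3.11): *«Let us consider G_□(U) and let us make a gauge transformation to the gauge in which U = e^{iηA}, A small … by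
(3.86) we get G_□(e^{iηA}) = G_□(1)(I − V(A)G_□(1))⁻¹»*; p. 396 (3.35): *«for an arbitrary cube □ of the described above class, and for a configuration U there
exists a gauge transformation u on □ such that U^u = e^{iηA} … |A| < O(1)Mα₀(Lʲη)⁻¹»*; p. 409: *«the cube □̃⁵ is contained in one of the cubes for which this
condition holds»*; p. 410: *«G′_□ depends on U restricted to Ω₀(□) ⊂ □̃⁵»*.

WHAT.  For a member `x`, a cover cube `c` (`j = j(c)`), W-a's local site set `D = □̃(c) = cubeDomY x c`, a block cut `χP`, a bond cut `χ` issuing from `□̃(c)`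
(`χ(b) ≠ 0 ⇒ e(b₋) ∈ D`), and `U` in print's class `(bg9YP 𝔸 G x).Reg335 cthr α₀ U` (`cthr ≤ 10`, `α₀ ≥ 0`):
★★★ `posDefTr_padDeltaALocY_of_ball_of_regYP335` — IF the padded local operator is positive along the pencil through `1` on the sup-ball of radius `r`,
`hball : ∀ A′, (∀ μ z, ‖A′ μ z‖ < r) → PosDefTr 1 (padDeltaALocY … (e^{iηA′}·1))`, and `2L⁴·(M·α₀)·(Lʲη)⁻¹ ≤ r`, THEN `PosDefTr 1 (padDeltaALocY … U)` — the
`hloc` input of `…N06Row19LocalClauseAtDirichletInverses.hGsqA_of_GAsqY_pins` AT THIS `U`.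
THE CHAIN (all landed): (3.35) on the class cube covering `□̃(c)` and its `(L−4)`-block collar (`B9Eq335CubeDomCoverWideP.reg335Cube_cubeDomY_wideCollar_of_regYP335`:
ONE gauge `u`, ONE field `A`, `U^u = e^{iηA}`, `|A| < 2L⁴Mα₀(Lʲη)⁻¹` on the collar) ⇒ truncate (`u′ := u` on the collar, `1` off it — unitary-valued by
`mem_unitary_of_norm_le_one_of_norm_inv_le_one`; `A′ := A` on the collar, `0` off it — `‖A′‖ < r`) ⇒ `U^{u′}` and `e^{iηA′}·1` agree on every bond with both
endpoints in the collar (`gaugeY_trunc_eq_prodCfg_trunc`) ⇒ def-Y's `AgreeNearBY (cubeDomY x c) χ (U^{u′}) (e^{iηA′})` (this seat's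
`B9DeltaALocalReadingsInCollarY.agreeNearBY_of_agree_on_collar`, radius `4L^{j+2} ≤ (L−4)S_j`) ⇒ `padDeltaALocY … (U^{u′}) = padDeltaALocY … (e^{iηA′})`
(def-Y A-3 `padDeltaALocY_parSymY_congr`) ⇒ positive by `hball` ⇒ positive at `U` (gauge covariance, this seat's F4b `posDefTr_padDeltaALocY_gaugeY_iff`).
HONEST FRAMING.  Composition over landed files; the ONE displayed input `hball` is ANALYTIC ([B9] Sect. B∕C in the cube: the N10 lane's L1–L5 road; at `A′ = 0`
it is this seat's F2∕F3 `posDefTr_padDeltaALocY_one(_cubeDomY)`), and its radius condition `2L⁴Mα₀(Lʲη)⁻¹ ≤ r` is print's «α₀ so small that O(1)Mα₀ is still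
sufficiently small»; Cor. 3.6 on (3.35) is NOT proved here; COUNT-NEUTRAL; N06 NOT discharged; nothing continuum ∕ OS ∕ mass gap ∕ Clay.  0 `def`, 0 `sorry`.
-/

noncomputable section

namespace Summit.QuantumFields.YangMills.BalabanUVNodes.N06Row17LocalClauseOnReg335

open Literature.MathematicalPhysics.QuantumFieldTheory.Balaban1983to89
open Literature.MathematicalPhysics.QuantumFieldTheory.Balaban1983to89.Node00
open Literature.MathematicalPhysics.QuantumFieldTheory.Balaban1983to89.Node00.OpsYDeltaALocal (padDeltaALocY)
open Literature.MathematicalPhysics.QuantumFieldTheory.Balaban1983to89.Node00.OpsYDeltaALocalAgree (padDeltaALocY_parSymY_congr)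
open Literature.MathematicalPhysics.QuantumFieldTheory.Balaban1983to89.B6KLevelCensusIndexV1 (KIdx kGeo)
open Literature.MathematicalPhysics.QuantumFieldTheory.Balaban1983to89.B6GlobalChartV1 (PV boxEquiv val_boxEquiv_symm)
open Literature.MathematicalPhysics.QuantumFieldTheory.Balaban1983to89.B9BackgroundsKLevelV1 (shiftsV1 CfgV1)
open Literature.MathematicalPhysics.QuantumFieldTheory.Balaban1983to89.B9BackgroundsKLevelV1P (bg9YP)
open Literature.MathematicalPhysics.QuantumFieldTheory.Balaban1983to89.B9PinMembersKLevelV1 (MemberY)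
open Literature.MathematicalPhysics.QuantumFieldTheory.Balaban1983to89.B6Cover236MultiLevelBlocks (cubes)
open Literature.MathematicalPhysics.QuantumFieldTheory.Balaban1983to89.B6MultiLevelBoxOperator (bigSide)
open Literature.MathematicalPhysics.QuantumFieldTheory.Balaban1983to89.B9WalkLettersCoordsS (cubeDomY)
open Literature.MathematicalPhysics.QuantumFieldTheory.Balaban1983to89.B9Thm37CubeCoverCommutators (cutMulY)
open Literature.MathematicalPhysics.QuantumFieldTheory.Balaban1983to89.B9Thm311ReadingCoords (PosDefTr)
open Literature.MathematicalPhysics.QuantumFieldTheory.Balaban1983to89.LatticeFieldCalculus (supDist)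
open Literature.MathematicalPhysics.QuantumFieldTheory.Balaban1983to89.LatticeNorms (scaleLen)
open Literature.MathematicalPhysics.QuantumFieldTheory.Balaban1983to89.B4TorusKernel.MultiPeriod (circAbs)
open Literature.MathematicalPhysics.QuantumFieldTheory.Balaban1983to89.B9Eq335CubeDomCoverWideP (reg335Cube_cubeDomY_wideCollar_of_regYP335 four_pow_le_collar)
open Literature.MathematicalPhysics.QuantumFieldTheory.Balaban1983to89.B9DeltaALocalReadingsInCollarY (agreeNearBY_of_agree_on_collar circAbs_le_of_supDist_le)
open Summit.QuantumFields.YangMills.BalabanUVNodes.N06Row17LocalClauseAtPureGauge (posDefTr_padDeltaALocY_gaugeY_iff)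
open scoped Matrix
open scoped Matrix.Norms.L2Operator

variable {N : ℕ} {d ℓ : ℕ} {hd : 1 ≤ d + 1} {hL : Odd (ℓ + 1) ∧ 1 < ℓ + 1} {b₀ b₁ : ℝ} {Mstar : ℕ}

/-! ## §1 The truncated cube gauge and the truncated small field -/

/-- an invertible matrix with `‖u‖ ≤ 1` and `‖u⁻¹‖ ≤ 1` (L²-operator norm) is unitary — r06's reading of «u on □» in (3.35) (`‖u‖, ‖u⁻¹‖ ≤ 1`) meets def-Y's
unitary-valued gauge functions. [cite: Balaban1985BackgroundPropagators, (3.35) p.396 («a gauge transformation u on □»), (3.28) p.395] -/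
theorem mem_unitary_of_norm_le_one_of_norm_inv_le_one {n : Type*} [Fintype n] [DecidableEq n]
    {A B : Matrix n n ℂ} (hBA : B * A = 1) (hA : ‖A‖ ≤ 1) (hB : ‖B‖ ≤ 1) : A ∈ unitary (Matrix n n ℂ) := by
  set T := Matrix.toEuclideanCLM (𝕜 := ℂ) (n := n) A with hT
  set Ti := Matrix.toEuclideanCLM (𝕜 := ℂ) (n := n) B with hTi
  have hTn : ‖T‖ ≤ 1 := by rw [hT, ← Matrix.cstar_norm_def]; exact hA
  have hTin : ‖Ti‖ ≤ 1 := by rw [hTi, ← Matrix.cstar_norm_def]; exact hB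
  have hcomp : Ti * T = 1 := by rw [hT, hTi, ← map_mul, hBA, map_one]
  have hiso : ∀ v, ‖T v‖ = ‖v‖ := by
    intro v
    apply le_antisymm
    · calc ‖T v‖ ≤ ‖T‖ * ‖v‖ := T.le_opNorm v
        _ ≤ 1 * ‖v‖ := mul_le_mul_of_nonneg_right hTn (norm_nonneg _)
        _ = ‖v‖ := one_mul _
    · have hv : v = Ti (T v) := by
        have := congrArg (fun S : EuclideanSpace ℂ n →L[ℂ] EuclideanSpace ℂ n => S v) hcomp
        simpa using this.symm
      calc ‖v‖ = ‖Ti (T v)‖ := by rw [← hv]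
        _ ≤ ‖Ti‖ * ‖T v‖ := Ti.le_opNorm _
        _ ≤ 1 * ‖T v‖ := mul_le_mul_of_nonneg_right hTin (norm_nonneg _)
        _ = ‖T v‖ := one_mul _
  have hadj : ContinuousLinearMap.adjoint T ∘L T = 1 := (ContinuousLinearMap.norm_map_iff_adjoint_comp_self T).1 hiso
  have hstar : star A * A = 1 := by
    have h1 : Matrix.toEuclideanCLM (𝕜 := ℂ) (n := n) (star A * A) = 1 := by
      rw [map_mul, map_star, ← hT, ContinuousLinearMap.star_eq_adjoint]
      exact hadj
    have h2 : Matrix.toEuclideanCLM (𝕜 := ℂ) (n := n) (star A * A) = Matrix.toEuclideanCLM (𝕜 := ℂ) (n := n) 1 := by rw [h1, map_one]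
    exact (Matrix.toEuclideanCLM (𝕜 := ℂ) (n := n)).injective h2
  exact Unitary.mem_iff.2 ⟨hstar, mul_eq_one_comm.1 hstar⟩

variable (i : KIdx d ℓ hd hL b₀ b₁)

/-- THE TRUNCATED CUBE GAUGE IS UNITARY-VALUED: if `‖u z‖ ≤ 1 ∧ ‖u z⁻¹‖ ≤ 1` on a set `W` (r06's `Reg335Cube` clause), then `z ↦ (z ∈ W ? u z : 1)` takes
unitary values everywhere. [cite: Balaban1985BackgroundPropagators, (3.35) p.396, (3.28) p.395] -/
theorem trunc_gauge_mem_unitary {W : Set (Site (PV d ℓ i.m i.K hd hL) 0)} [DecidablePred (· ∈ W)]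
    {u : Site (PV d ℓ i.m i.K hd hL) 0 → (Matrix (Fin N) (Fin N) ℂ)ˣ}
    (hu : ∀ z ∈ W, ‖((u z : (Matrix (Fin N) (Fin N) ℂ)ˣ) : Matrix (Fin N) (Fin N) ℂ)‖ ≤ 1 ∧ ‖(((u z)⁻¹ : (Matrix (Fin N) (Fin N) ℂ)ˣ) : Matrix (Fin N) (Fin N) ℂ)‖ ≤ 1)
    (z : Site (PV d ℓ i.m i.K hd hL) 0) :
    (((if z ∈ W then u z else 1 : (Matrix (Fin N) (Fin N) ℂ)ˣ)) : Matrix (Fin N) (Fin N) ℂ) ∈ unitary (Matrix (Fin N) (Fin N) ℂ) := by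
  by_cases hz : z ∈ W
  · rw [if_pos hz]
    exact mem_unitary_of_norm_le_one_of_norm_inv_le_one (by rw [← Units.val_mul, inv_mul_cancel, Units.val_one]) (hu z hz).1 (hu z hz).2
  · rw [if_neg hz, Units.val_one]
    exact Submonoid.one_mem _

/-- THE CUBE GAUGE AND THE FLUCTUATION FIELD AGREE ON THE BONDS OF THE COLLAR: if `U^u = e^{iηA}` on `W` (r06's `gaugeTr (shiftsV1) u U κ z = fluct η A κ z`,
`z ∈ W`), then `U^{u′}` for the truncated gauge `u′` and the pencil point `e^{iηA′}·1` of the truncated field `A′` agree on every bond with BOTH endpoints in `W`.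
[cite: Balaban1985BackgroundPropagators, (3.35) p.396 («U^u = e^{iηA}» on □), (3.28) p.395, p.416] -/
theorem gaugeY_trunc_eq_prodCfg_trunc {𝔸 : Type} [NormedRing 𝔸] [NormedAlgebra ℂ 𝔸] [CompleteSpace 𝔸]
    {W : Set (Site (PV d ℓ i.m i.K hd hL) 0)} [DecidablePred (· ∈ W)] {u : Site (PV d ℓ i.m i.K hd hL) 0 → 𝔸ˣ} {U : CfgY 𝔸 i} {η : ℝ}
    {A : Fin (PV d ℓ i.m i.K hd hL).d → Site (PV d ℓ i.m i.K hd hL) 0 → 𝔸}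
    (hg : ∀ κ, ∀ z ∈ W, B9Eq3117Current.gaugeTr (shiftsV1 _) u U κ z = B9Eq39Adjoint.fluct η A κ z)
    {κ : Fin (PV d ℓ i.m i.K hd hL).d} {z : Site (PV d ℓ i.m i.K hd hL) 0} (hz : z ∈ W) (hzκ : z.shift κ ∈ W) :
    gaugeY i (fun z => if z ∈ W then u z else 1) U κ z =
      B9Eq39Adjoint.prodCfg (fun _ _ => (1 : 𝔸ˣ)) η (fun κ z => if z ∈ W then A κ z else 0) κ z := by
  rw [gaugeY_apply, if_pos hz, if_pos hzκ]
  show u z * U κ z * (u (z.shift κ))⁻¹ = B9Eq39Adjoint.fluct η (fun κ z => if z ∈ W then A κ z else 0) κ z * 1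
  rw [mul_one]
  have h := hg κ z hz
  rw [B9Eq3117Current.gaugeTr_apply] at h
  have e : B9Eq39Adjoint.fluct η (fun κ z => if z ∈ W then A κ z else 0) κ z = B9Eq39Adjoint.fluct η A κ z := by
    unfold B9Eq39Adjoint.fluct; simp only [if_pos hz]
  rw [e, ← h]
  rfl

/-- THE TRUNCATED FIELD IS SMALL EVERYWHERE: `‖A′ κ z‖ < r` for all `κ, z` if `|A| < C·ξ⁻¹` on `W` and `C·ξ⁻¹ ≤ r`, `0 < r`.
[cite: Balaban1985BackgroundPropagators, (3.35) p.396 («|A| < O(1)Mα₀(Lʲη)⁻¹»)] -/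
theorem norm_trunc_lt {𝔸 : Type} [NormedRing 𝔸] {W : Set (Site (PV d ℓ i.m i.K hd hL) 0)} [DecidablePred (· ∈ W)]
    {A : Fin (PV d ℓ i.m i.K hd hL).d → Site (PV d ℓ i.m i.K hd hL) 0 → 𝔸} {C ξ r : ℝ}
    (hA : ∀ κ, ∀ z ∈ W, ‖A κ z‖ < C * ξ⁻¹) (hCr : C * ξ⁻¹ ≤ r) (hr : 0 < r) (κ : Fin (PV d ℓ i.m i.K hd hL).d) (z : Site (PV d ℓ i.m i.K hd hL) 0) :
    ‖(fun κ z => if z ∈ W then A κ z else 0 : Fin (PV d ℓ i.m i.K hd hL).d → Site (PV d ℓ i.m i.K hd hL) 0 → 𝔸) κ z‖ < r := by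
  by_cases hz : z ∈ W
  · simp only [if_pos hz]; exact lt_of_lt_of_le (hA κ z hz) hCr
  · simp only [if_neg hz, norm_zero]; exact hr

/-! ## §2 ★★★ `hloc` on print's class from the chart-ball positivity -/

/-- ★★★ **ROW 17's LOCAL CLAUSE ON (3.35) FROM THE CHART-BALL POSITIVITY** (print's p. 416 road, the gauge ∕ locality ∕ class-cube steps PROVED): for a member
`x`, a cover cube `c`, W-a's `D = cubeDomY x c`, cuts `χP`, `χ` with `supp χ` issuing from `□̃(c)`, and `U ∈ (bg9YP (M_N(ℂ)) G x).Reg335 cthr α₀` (`cthr ≤ 10`,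
`α₀ ≥ 0`): if `PosDefTr 1 (padDeltaALocY … (e^{iηA′}·1))` for every `A′` in the sup-ball of radius `r > 0` (the N10 lane's L5, displayed) and
`2L⁴·(M·α₀)·(L^{j(c)}η)⁻¹ ≤ r`, then **`PosDefTr 1 (padDeltaALocY x.toKIdx (parSymY _) (parBY _) (cubeDomY x c) (cutMulY χP) (cutMulY χ) U)`**.
[cite: Balaban1985BackgroundPropagators, Thm 3.11 proof p.416, (3.35) p.396, p.409 («□̃⁵ ⊂ one class cube»), p.410 L14–15, Cor. 3.6 p.408] -/
theorem posDefTr_padDeltaALocY_of_ball_of_regYP335 [Nonempty (Fin N)] {G : Subgroup (Matrix (Fin N) (Fin N) ℂ)ˣ}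
    (x : MemberY d ℓ hd hL b₀ b₁ Mstar) (c : ↥(cubes x.toKIdx.D.toDomains)) (χP : BlkY x.toKIdx → ℝ) {χ : FBondY x.toKIdx → ℝ}
    (hχD : ∀ b, χ b ≠ 0 → boxEquiv x.toKIdx.hN b.src ∈ cubeDomY x c)
    {cthr α₀ : ℝ} (hc : cthr ≤ 10) (hα : 0 ≤ α₀) {U : CfgV1 (PV d ℓ x.m x.K hd hL) (Matrix (Fin N) (Fin N) ℂ)}
    (hreg : (bg9YP (Matrix (Fin N) (Fin N) ℂ) G x).Reg335 cthr α₀ U) {r : ℝ} (hr : 0 < r)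
    (hball : ∀ A' : Fin (d + 1) → Site (PV d ℓ x.m x.K hd hL) 0 → Matrix (Fin N) (Fin N) ℂ, (∀ μ z, ‖A' μ z‖ < r) →
      PosDefTr (fun _ => (1 : ℝ)) (padDeltaALocY x.toKIdx (parSymY x.toKIdx) (parBY x.toKIdx) (cubeDomY x c) (cutMulY χP) (cutMulY χ)
        (B9Eq39Adjoint.prodCfg (1 : CfgY (Matrix (Fin N) (Fin N) ℂ) x.toKIdx) (kGeo x.toKIdx).eta A')))
    (hCr : 2 * (kGeo x.toKIdx).L ^ 4 * ((kGeo x.toKIdx).M * α₀) * (scaleLen (kGeo x.toKIdx).L (kGeo x.toKIdx).eta c.1.1)⁻¹ ≤ r) :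
    PosDefTr (fun _ => (1 : ℝ)) (padDeltaALocY x.toKIdx (parSymY x.toKIdx) (parBY x.toKIdx) (cubeDomY x c) (cutMulY χP) (cutMulY χ) U) := by
  classical
  -- (3.35) on the wide collar of `□̃(c)`: one gauge, one small field
  obtain ⟨u, A, hu, hg, hA, -⟩ := reg335Cube_cubeDomY_wideCollar_of_regYP335 (𝔸 := Matrix (Fin N) (Fin N) ℂ) (G := G) x c hc hα hreg
  set W : Set (Site (PV d ℓ x.m x.K hd hL) 0) := {w | ∃ z ∈ cubeDomY x c, ∀ μ,
    circAbs ((PV d ℓ x.m x.K hd hL).sitesPerDir 0) (((w μ).val : ℤ) - z.1 μ) ≤ ((ℓ : ℤ) - 3) * (bigSide ℓ x.Mh c.1.1 : ℤ)} with hWdef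
  -- the truncations
  set u' : Site (PV d ℓ x.m x.K hd hL) 0 → (Matrix (Fin N) (Fin N) ℂ)ˣ := fun z => if z ∈ W then u z else 1 with hu'def
  set A' : Fin (d + 1) → Site (PV d ℓ x.m x.K hd hL) 0 → Matrix (Fin N) (Fin N) ℂ := fun κ z => if z ∈ W then A κ z else 0 with hA'def
  have hunit : ∀ z, ((u' z : (Matrix (Fin N) (Fin N) ℂ)ˣ) : Matrix (Fin N) (Fin N) ℂ) ∈ unitary (Matrix (Fin N) (Fin N) ℂ) :=
    fun z => trunc_gauge_mem_unitary x.toKIdx hu z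
  have hA' : ∀ μ z, ‖A' μ z‖ < r := fun μ z => norm_trunc_lt x.toKIdx hA hCr hr μ z
  have hPD' := hball A' hA'
  -- agreement on the collar ⇒ `AgreeNearBY`
  have hℓ : 4 ≤ ℓ := x.toKIdx.hℓ
  have hK := four_pow_le_collar x.toKIdx c.1.1
  have hcast : (((ℓ - 3) * bigSide ℓ x.Mh c.1.1 : ℕ) : ℤ) = ((ℓ : ℤ) - 3) * (bigSide ℓ x.Mh c.1.1 : ℤ) := by
    rw [Nat.cast_mul, Nat.cast_sub (by omega : 3 ≤ ℓ)]; push_cast; ring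
  have hmemW : ∀ {z : SiteY x.toKIdx} (_ : z ∈ cubeDomY x c) {w : Site (PV d ℓ x.m x.K hd hL) 0},
      supDist ((boxEquiv x.toKIdx.hN).symm z) w ≤ (ℓ - 3) * bigSide ℓ x.Mh c.1.1 → w ∈ W := by
    intro z hz w hw
    refine ⟨z, hz, fun μ => ?_⟩
    rw [← hcast]
    exact circAbs_le_of_supDist_le x.toKIdx hw μ
  have hagree : ∀ κ w, (∃ z ∈ cubeDomY x c, supDist ((boxEquiv x.toKIdx.hN).symm z) w ≤ (ℓ - 3) * bigSide ℓ x.Mh c.1.1 ∧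
      supDist ((boxEquiv x.toKIdx.hN).symm z) (w.shift κ) ≤ (ℓ - 3) * bigSide ℓ x.Mh c.1.1) →
      gaugeY x.toKIdx u' U κ w = B9Eq39Adjoint.prodCfg (1 : CfgY (Matrix (Fin N) (Fin N) ℂ) x.toKIdx) (kGeo x.toKIdx).eta A' κ w := by
    rintro κ w ⟨z, hz, h1, h2⟩
    exact gaugeY_trunc_eq_prodCfg_trunc x.toKIdx hg (hmemW hz h1) (hmemW hz h2)
  have hAN := agreeNearBY_of_agree_on_collar (𝔸 := Matrix (Fin N) (Fin N) ℂ) x c hK hχD hagree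
  -- locality (def-Y A-3) and the ball positivity
  have heq := padDeltaALocY_parSymY_congr (D := cubeDomY x c) (cutMulY χP) (χ := χ) hAN
  have hPDg : PosDefTr (fun _ => (1 : ℝ)) (padDeltaALocY x.toKIdx (parSymY x.toKIdx) (parBY x.toKIdx) (cubeDomY x c) (cutMulY χP) (cutMulY χ)
      (gaugeY x.toKIdx u' U)) := by
    rw [heq]; exact hPD'
  -- back to `U` along the gauge orbit
  exact (posDefTr_padDeltaALocY_gaugeY_iff x.toKIdx hunit (cubeDomY x c) χP χ U).1 hPDg

end Summit.QuantumFields.YangMills.BalabanUVNodes.N06Row17LocalClauseOnReg335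

end
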